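import Summits.ResolutionOfSingularities.ResolutionOfSingularities.Theorems.EquisingularLiftEquisingularLiftNatOccursAsSingularLocus
import Mathlib.RingTheory.KrullDimension.Basic
import Mathlib.RingTheory.Ideal.MinimalPrime.Noetherian
import HarnessLib

/-!
# [OURS · L1 W4.5(b)] Helper H-L0b, part 3: TRANSVERSAL TYPE `A₁` OFF FINITELY MANY POINTS of `Σ`
# for the generic member of a `𝔭²`-system — crux `EquisingularLiftNat` (EL♮,
# stmt-ResolutionOfSingularities-20038), line `sections`, research stub `stub_elnat_three`

NOT a statement of any manuscript. Add-on to parts 1–2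
(`Theorems/EquisingularLiftEquisingularLiftNatOccursAsSingularLocus.lean` p500339: closed singular
locus of the generic member `= V(𝔭)`; `…OrdTwo.lean` p500916: order exactly `2` at the generic point).
CRUX-PLAN v3.0.1 §1.3 (b): «`H := V(G)`, `G` generic in `H⁰(𝓘_Σ²(d))`, … `Sing H = Σ`, transversal
type `A₁` off finitely many points».

**Setting (a chart on which `Σ` is a complete intersection).** `A` a `k`-algebra, `𝔭 = (y, z)` (a
smooth curve in a smooth threefold is Zariski-locally cut out by two of three local coordinates, so
finitely many such charts cover `Σ`), and a linear system of members of `𝔭² = (y², yz, z²)` given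
WITH presentations `uⱼ = aⱼ·y² + bⱼ·yz + cⱼ·z²`. For a coefficient vector `t` write
`s_t = a_t y² + b_t yz + c_t z²` (`a_t = Σ tⱼaⱼ`, …; `linComb_presentation`). The TRANSVERSAL QUADRATIC
FORM of `s_t` at a closed point `𝔪 ⊇ 𝔭` is `ā_t Y² + b̄_t YZ + c̄_t Z²` over `k = A ⧸ 𝔪`, and
**«transversal type `A₁` at `𝔪`» is rendered as: its discriminant `D_t := b_t² − 4 a_t c_t` is a unit
at `𝔪`, `D_t ∉ 𝔪`** (over `k = k̄` a binary quadratic form splits into two NON-proportional linear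
factors iff its discriminant is non-zero; in characteristic `2` this reads `b̄_t ≠ 0`, uniformly).
HONESTY NOTE on the rendering: `D_t ∉ 𝔪` is a statement about the chosen presentation; it MEANS
«the transversal plane-curve germ of `V(s_t)` at `𝔪` is an ordinary node» exactly at the closed points
`𝔪 ⊇ 𝔭` where `y, z` are part of a regular system of parameters of `A_𝔪` — all closed points of the
chart when `A` is regular and `Σ = V(y, z)` is regular (then `s_t ≡ ā_t y² + b̄_t yz + c̄_t z²`
modulo `𝔪·(y, z)²` is its leading form in the two normal coordinates). The theorems below do not use
regularity of `Σ`; they prove the algebraic statement `D_t ∉ 𝔪` off a finite set.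

* `linComb_presentation` — `s_t = a_t y² + b_t yz + c_t z²`.
* `isGeneric_disc_notMem` — if SOME member has non-zero discriminant at the closed point `𝔪₀`, then
  the GENERIC member does (the test polynomial is `D_t` read in `A ⧸ 𝔪₀ ≅ k`).
* `setOf_isMaximal_finite_of_notMem` — for a prime `𝔭` with `dim A ⧸ 𝔭 ≤ 1` (a curve) and `D ∉ 𝔭`,
  only finitely many closed points of `V(𝔭)` contain `D` (they are minimal primes of `𝔭 + (D)`).
* `isGeneric_transversalA1_off_finite` — hence, if the system contains `yz` itself (so `D = 1` for
  that member), for generic `t`: `D_t ∉ 𝔭` and the closed points `𝔪 ⊇ 𝔭` with `D_t ∈ 𝔪` are FINITE: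
  transversal type `A₁` at all but finitely many closed points of `Σ` (on this chart).
* `occurs_as_singular_locus_transversalA1` — **H-L0b on a complete-intersection chart, all three
  clauses at once**: for a regular domain `A` of finite type over `k = k̄`, `𝔭 = (y, z)` prime with
  `dim A ⧸ 𝔭 ≤ 1`, `yz ≠ 0`, and a presented system in `𝔭²` containing `yz` and separating tangent
  vectors off `V(𝔭)`: for generic `t`, `s_t ≠ 0`, `s_t ∈ 𝔭²`, closed singular locus of `V(s_t)` is
  exactly `V(𝔭)` (part 1), and transversal type `A₁` off finitely many closed points of `V(𝔭)`.

Still NOT covered: integrality of `V(s_t)` for `d ≫ 0` (irreducibility needs a Bertini-irreducibility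
fact), and the projective gluing of charts. References: Hartshorne II Thm. 8.18 [Hartshorne1977];
Matsumura Thm. 14.2 [Matsumura1987].
-/

set_option linter.dupNamespace false -- mandated namespace `Summit.<Summit>.<Problem>` of this single-conjunct summit

noncomputable section

open IsLocalRing MvPolynomial

universe u v

namespace Summit.ResolutionOfSingularities.ResolutionOfSingularities.Cruxes.EquisingularLiftNat.Sections

open Literature.AlgebraicGeometry.Resolution Literature.AlgebraicGeometry.Resolution.BertiniAffine

variable {k : Type u} [Field k] {A : Type u} [CommRing A] [Algebra k A]
variable {ι : Type v} [Fintype ι]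

/-- **Presentations are linear**: if `uⱼ = aⱼ y² + bⱼ yz + cⱼ z²` then
`s_t = a_t y² + b_t yz + c_t z²` with `a_t = Σ tⱼ aⱼ` etc. [folklore] [OURS · L1 W4.5b] -/
theorem linComb_presentation {u a b c : ι → A} {y z : A}
    (hu : ∀ j, u j = a j * y ^ 2 + b j * (y * z) + c j * z ^ 2) (t : ι → k) :
    linComb u t = linComb a t * y ^ 2 + linComb b t * (y * z) + linComb c t * z ^ 2 := by
  simp only [linComb, hu, smul_add, Finset.sum_add_distrib, Finset.sum_mul, smul_mul_assoc]

/-- Members of a presented `(y, z)²`-system lie in `𝔭²` for `𝔭 = (y, z)`. [folklore] [OURS · L1 W4.5b] -/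
theorem linComb_mem_sq_of_presentation {u a b c : ι → A} {y z : A} {𝔭 : Ideal A}
    (hyz : 𝔭 = Ideal.span {y, z})
    (hu : ∀ j, u j = a j * y ^ 2 + b j * (y * z) + c j * z ^ 2) (t : ι → k) :
    linComb u t ∈ 𝔭 ^ 2 := by
  have hy : y ∈ 𝔭 := by rw [hyz]; exact Ideal.subset_span (by simp)
  have hz : z ∈ 𝔭 := by rw [hyz]; exact Ideal.subset_span (by simp)
  rw [linComb_presentation hu, pow_two 𝔭]
  refine add_mem (add_mem ?_ ?_) ?_
  · rw [pow_two]; exact Ideal.mul_mem_left _ _ (Ideal.mul_mem_mul hy hy)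
  · exact Ideal.mul_mem_left _ _ (Ideal.mul_mem_mul hy hz)
  · rw [pow_two]; exact Ideal.mul_mem_left _ _ (Ideal.mul_mem_mul hz hz)

/-- **Generic non-degeneracy of the transversal quadratic form at one closed point**: for `A` of
finite type over an algebraically closed field `k`, a maximal ideal `𝔪₀`, and presentations
`a b c : ι → A`, if SOME coefficient vector `t₀` has discriminant `b_{t₀}² − 4 a_{t₀} c_{t₀} ∉ 𝔪₀`,
then `b_t² − 4 a_t c_t ∉ 𝔪₀` for GENERIC `t`: read in `A ⧸ 𝔪₀ ≅ k` the discriminant is the value of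
a polynomial in `t` over `k`, non-zero since it does not vanish at `t₀`. [folklore]
[OURS · L1 W4.5b] helper for H-L0b; NOT a statement of the manuscript. -/
theorem isGeneric_disc_notMem [IsAlgClosed k] [Algebra.FiniteType k A] (a b c : ι → A)
    (𝔪₀ : Ideal A) [𝔪₀.IsMaximal]
    (hex : ∃ t₀ : ι → k, linComb b t₀ ^ 2 - 4 * linComb a t₀ * linComb c t₀ ∉ 𝔪₀) :
    IsGeneric fun t : ι → k => linComb b t ^ 2 - 4 * linComb a t * linComb c t ∉ 𝔪₀ := by
  classical
  -- `A ⧸ 𝔪₀ ≅ k`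
  let e : k ≃+* A ⧸ 𝔪₀ :=
    RingEquiv.ofBijective (algebraMap k (A ⧸ 𝔪₀)) (algebraMap_quotient_bijective 𝔪₀)
  have he : ∀ x : k, e x = algebraMap k (A ⧸ 𝔪₀) x := fun _ => rfl
  -- the linear forms `Σ ā ⱼXⱼ` etc. over `k`
  let L : (ι → A) → MvPolynomial ι k := fun f => ∑ j, C (e.symm (Ideal.Quotient.mk 𝔪₀ (f j))) * X j
  have hL : ∀ (f : ι → A) (t : ι → k),
      e (MvPolynomial.eval t (L f)) = Ideal.Quotient.mk 𝔪₀ (linComb f t) := by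
    intro f t
    simp only [L, map_sum, map_mul, MvPolynomial.eval_C, MvPolynomial.eval_X,
      RingEquiv.apply_symm_apply, linComb]
    refine Finset.sum_congr rfl fun j _ => ?_
    rw [Algebra.smul_def, map_mul, he, ← Ideal.Quotient.mk_algebraMap, mul_comm]
  let Φ : MvPolynomial ι k := L b ^ 2 - 4 * L a * L c
  have hΦ : ∀ t : ι → k, e (MvPolynomial.eval t Φ) =
      Ideal.Quotient.mk 𝔪₀ (linComb b t ^ 2 - 4 * linComb a t * linComb c t) := by
    intro t
    simp only [Φ, map_sub, map_mul, map_pow, hL, map_ofNat]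
  have hΦ0 : Φ ≠ 0 := by
    obtain ⟨t₀, ht₀⟩ := hex
    intro h0
    apply ht₀
    rw [← Ideal.Quotient.eq_zero_iff_mem, ← hΦ, h0, map_zero, map_zero]
  refine ⟨Φ, hΦ0, fun t ht hmem => ht ?_⟩
  apply e.injective
  rw [hΦ, map_zero, Ideal.Quotient.eq_zero_iff_mem]
  exact hmem

omit [Algebra k A] in
/-- **Only finitely many closed points of a curve contain a function not vanishing on it**: for a
prime `𝔭` of a Noetherian ring `A` with `dim A ⧸ 𝔭 ≤ 1` and `D ∉ 𝔭`, the maximal ideals `𝔪 ⊇ 𝔭`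
with `D ∈ 𝔪` are among the (finitely many) minimal primes of `𝔭 + (D)`: a minimal prime `𝔮 ⊆ 𝔪`
of `𝔭 + (D)` is a NON-ZERO prime of the at-most-one-dimensional domain `A ⧸ 𝔭`, hence maximal,
hence `𝔮 = 𝔪`. [folklore] [OURS · L1 W4.5b] helper for H-L0b. -/
theorem setOf_isMaximal_finite_of_notMem [IsNoetherianRing A] (𝔭 : Ideal A) [𝔭.IsPrime]
    (hdim : ringKrullDim (A ⧸ 𝔭) ≤ 1) {D : A} (hD : D ∉ 𝔭) :
    {𝔪 : Ideal A | 𝔪.IsMaximal ∧ 𝔭 ≤ 𝔪 ∧ D ∈ 𝔪}.Finite := by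
  haveI : Ring.KrullDimLE 1 (A ⧸ 𝔭) := Ring.krullDimLE_iff.2 hdim
  let J : Ideal A := 𝔭 ⊔ Ideal.span {D}
  refine (Ideal.finite_minimalPrimes_of_isNoetherianRing A J).subset fun 𝔪 h𝔪 => ?_
  obtain ⟨h𝔪, hp𝔪, hD𝔪⟩ := h𝔪
  haveI := h𝔪
  have hJ𝔪 : J ≤ 𝔪 := sup_le hp𝔪 ((Ideal.span_singleton_le_iff_mem _).2 hD𝔪)
  obtain ⟨q, hq, hq𝔪⟩ := Ideal.exists_minimalPrimes_le hJ𝔪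
  haveI hqp : q.IsPrime := hq.1.1
  have hpq : 𝔭 ≤ q := le_sup_left.trans hq.1.2
  have hDq : D ∈ q := hq.1.2 (Ideal.mem_sup_right (Ideal.mem_span_singleton_self D))
  -- `q ⧸ 𝔭` is a non-zero prime of `A ⧸ 𝔭`, hence maximal
  have hker : RingHom.ker (Ideal.Quotient.mk 𝔭) ≤ q := by rw [Ideal.mk_ker]; exact hpq
  haveI hq' : (q.map (Ideal.Quotient.mk 𝔭)).IsPrime :=
    Ideal.map_isPrime_of_surjective Ideal.Quotient.mk_surjective hker
  have hne : q.map (Ideal.Quotient.mk 𝔭) ≠ ⊥ := by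
    intro h
    apply hD
    have hmem : Ideal.Quotient.mk 𝔭 D ∈ q.map (Ideal.Quotient.mk 𝔭) := Ideal.mem_map_of_mem _ hDq
    rw [h, Ideal.mem_bot, Ideal.Quotient.eq_zero_iff_mem] at hmem
    exact hmem
  haveI hmax' : (q.map (Ideal.Quotient.mk 𝔭)).IsMaximal := hq'.isMaximal_of_ne_bot hne
  have hqmax : q.IsMaximal := by
    have h1 := Ideal.comap_isMaximal_of_surjective (Ideal.Quotient.mk 𝔭) Ideal.Quotient.mk_surjective
      (K := q.map (Ideal.Quotient.mk 𝔭))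
    rw [Ideal.comap_map_of_surjective _ Ideal.Quotient.mk_surjective, ← RingHom.ker_eq_comap_bot,
      sup_eq_left.2 hker] at h1
    exact h1
  have hq𝔪eq : q = 𝔪 := hqmax.eq_of_le h𝔪.ne_top hq𝔪
  exact hq𝔪eq ▸ hq

/-- **Transversal type `A₁` off finitely many points (generic member, complete-intersection chart)**:
`A` of finite type over `k = k̄`, `𝔭` a prime with `dim A ⧸ 𝔭 ≤ 1` (the curve `Σ`), presentations
`a b c : ι → A` of a `(y, z)²`-system one of whose members is `yz` itself (`a j₀ = 0`, `b j₀ = 1`,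
`c j₀ = 0`). Then for GENERIC `t` the discriminant `D_t = b_t² − 4 a_t c_t` of the transversal
quadratic form does not vanish identically on `Σ` (`D_t ∉ 𝔭`) and the closed points `𝔪 ⊇ 𝔭` where
it vanishes are FINITE — i.e. the transversal form `ā_t Y² + b̄_t YZ + c̄_t Z²` is non-degenerate (two
distinct tangent lines: an ordinary node transversally) at all but finitely many closed points of
`V(𝔭)`. [folklore; Hartshorne1977 II 8.18-style genericity] [OURS · L1 W4.5b] helper for H-L0b; NOT a
statement of the manuscript. -/
theorem isGeneric_transversalA1_off_finite [IsAlgClosed k] [Algebra.FiniteType k A]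
    (𝔭 : Ideal A) [𝔭.IsPrime] (hdim : ringKrullDim (A ⧸ 𝔭) ≤ 1) (a b c : ι → A)
    (hj : ∃ j₀, a j₀ = 0 ∧ b j₀ = 1 ∧ c j₀ = 0) :
    IsGeneric fun t : ι → k =>
      linComb b t ^ 2 - 4 * linComb a t * linComb c t ∉ 𝔭 ∧
      {𝔪 : Ideal A | 𝔪.IsMaximal ∧ 𝔭 ≤ 𝔪 ∧
        linComb b t ^ 2 - 4 * linComb a t * linComb c t ∈ 𝔪}.Finite := by
  classical
  haveI : IsNoetherianRing A := Algebra.FiniteType.isNoetherianRing k A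
  -- a closed point `𝔪₀` of `V(𝔭)`
  obtain ⟨𝔪₀, h𝔪₀, hp𝔪₀⟩ := Ideal.exists_le_maximal 𝔭 (Ideal.IsPrime.ne_top inferInstance)
  haveI := h𝔪₀
  -- the member `yz` has discriminant `1`
  obtain ⟨j₀, ha, hb, hc⟩ := hj
  have hex : ∃ t₀ : ι → k, linComb b t₀ ^ 2 - 4 * linComb a t₀ * linComb c t₀ ∉ 𝔪₀ := by
    refine ⟨Pi.single j₀ 1, ?_⟩
    have h1 : ∀ f : ι → A, linComb f (Pi.single j₀ (1 : k)) = f j₀ := fun f => by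
      simp [linComb, Pi.single_apply, Finset.sum_ite_eq', Finset.mem_univ]
    rw [h1, h1, h1, ha, hb, hc]
    simpa using (Ideal.ne_top_iff_one 𝔪₀).1 h𝔪₀.ne_top
  refine (isGeneric_disc_notMem (k := k) a b c 𝔪₀ hex).mono fun t ht => ?_
  have hnot : linComb b t ^ 2 - 4 * linComb a t * linComb c t ∉ 𝔭 := fun h => ht (hp𝔪₀ h)
  exact ⟨hnot, setOf_isMaximal_finite_of_notMem 𝔭 hdim hnot⟩

/-- **H-L0b on a complete-intersection chart, all clauses (`occurs_as_singular_locus_transversalA1`).**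
Let `A` be a regular domain of finite type over an algebraically closed field `k`, `𝔭 = (y, z)` a
prime with `dim A ⧸ 𝔭 ≤ 1` and `yz ≠ 0` (an affine chart of a smooth curve `Σ` in a smooth
threefold, on which `Σ` is cut out by two coordinates), and `uⱼ = aⱼ y² + bⱼ yz + cⱼ z²` a presented
linear system in `𝔭²` containing the member `yz` and separating tangent vectors at the closed points
off `V(𝔭)` (the chart of `|𝓘_Σ²(d)|`, `d ≫ 0`). Then for GENERIC `t` (`k` infinite ⇒ such `t` exist):
`s_t ≠ 0`, `s_t ∈ 𝔭²`; for every closed point `𝔪 ∋ s_t`, `A_𝔪 ⧸ (s_t)` is regular iff `𝔪 ⊉ 𝔭`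
(**`Sing V(s_t) = V(𝔭)` on closed points**, part 1); and the transversal discriminant
`D_t = b_t² − 4a_t c_t ∉ 𝔭` with `{𝔪 ⊇ 𝔭 closed : D_t ∈ 𝔪}` finite (**transversal type `A₁` off
finitely many closed points of `Σ`**). NOT covered: integrality of `V(s_t)`, projective gluing.
[cite: Hartshorne1977, II Thm. 8.18] [cite: Matsumura1987, Thm. 14.2] [OURS · L1 W4.5b] helper H-L0b
toward `stub_elnat_three` of crux `EquisingularLiftNat` (stmt-ResolutionOfSingularities-20038); NOT a
statement of the manuscript. -/
theorem occurs_as_singular_locus_transversalA1 [IsAlgClosed k] [IsRegularRing A] [IsDomain A]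
    [Algebra.FiniteType k A] (𝔭 : Ideal A) [𝔭.IsPrime] (hdim : ringKrullDim (A ⧸ 𝔭) ≤ 1)
    {y z : A} (hyz : 𝔭 = Ideal.span {y, z}) (hyz0 : y * z ≠ 0)
    (u a b c : ι → A) (hu : ∀ j, u j = a j * y ^ 2 + b j * (y * z) + c j * z ^ 2)
    (hj : ∃ j₀, a j₀ = 0 ∧ b j₀ = 1 ∧ c j₀ = 0)
    (hoff : ∀ 𝔪 : Ideal A, 𝔪.IsMaximal → ¬ 𝔭 ≤ 𝔪 →
      Function.Surjective (linCombQuotSq (k := k) u 𝔪)) :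
    IsGeneric fun t : ι → k =>
      linComb u t ≠ 0 ∧ linComb u t ∈ 𝔭 ^ 2 ∧
      (∀ (𝔪 : Ideal A) [𝔪.IsMaximal], linComb u t ∈ 𝔪 →
        (IsRegularLocalRing (Localization.AtPrime 𝔪 ⧸
            Ideal.span {algebraMap A (Localization.AtPrime 𝔪) (linComb u t)}) ↔ ¬ 𝔭 ≤ 𝔪)) ∧
      linComb b t ^ 2 - 4 * linComb a t * linComb c t ∉ 𝔭 ∧
      {𝔪 : Ideal A | 𝔪.IsMaximal ∧ 𝔭 ≤ 𝔪 ∧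
        linComb b t ^ 2 - 4 * linComb a t * linComb c t ∈ 𝔪}.Finite := by
  classical
  obtain ⟨j₀, ha, hb, hc⟩ := hj
  have huj₀ : u j₀ = y * z := by rw [hu, ha, hb, hc]; ring
  have hne : ∃ j, u j ≠ 0 := ⟨j₀, by rwa [huj₀]⟩
  have hmem : ∀ t : ι → k, linComb u t ∈ 𝔭 ^ 2 := linComb_mem_sq_of_presentation hyz hu
  have hA := isGeneric_isRegularLocalRing_quotient_linComb_off (k := k) 𝔭 u hoff
  have hB := isGeneric_linComb_ne_zero (k := k) u hne
  have hC := isGeneric_transversalA1_off_finite (k := k) 𝔭 hdim a b c ⟨j₀, ha, hb, hc⟩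
  refine ((hA.and hB).and hC).mono fun t ht => ⟨ht.1.2, hmem t, fun 𝔪 h𝔪 hst =>
    ⟨fun hreg hp𝔪 => ?_, fun hp𝔪 => ht.1.1 𝔪 hp𝔪 hst⟩, ht.2.1, ht.2.2⟩
  exact not_isRegularLocalRing_quotient_of_mem_sq 𝔪 ht.1.2 (Ideal.pow_right_mono hp𝔪 2 (hmem t)) hreg

end Summit.ResolutionOfSingularities.ResolutionOfSingularities.Cruxes.EquisingularLiftNat.Sections

end
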